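import Literature.Analysis.Hypoelliptic.ShadowLin
import HarnessLib

/-!
# The dictionary, II: the shadow of a convolution coefficient is multiplication

Analysis/Hypoelliptic support file serving the discharge of
`Literature.Analysis.Distribution.Hormander1967_thm11` (dictionary between Fourier-side
operators and `x`-side differential operators), continuing `ShadowLin.lean`.

For a real smooth function `a` on `E` with `b := a ∘ T⁻¹` a Schwartz function on `V`
(e.g. `a` compactly supported), let `θ_b := conj ∘ 𝓕 b`. Then

* `kerOp (adjKer (convKer θ_b)) ψ = 𝓕⁻¹ (b · 𝓕ψ)` for Schwartz `ψ` (Fubini,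
  `kerOp_adjKer_convKer_thetaOf`);
* `θ_b` is rapidly decreasing, and `reflConj θ_b = θ_b` when `b` is real
  (`rapidDecay_thetaOf`, `reflConj_thetaOf`);
* **shadow of a convolution** (`Rep.conv`): if `H` represents `R` then
  `kerOp (convKer θ_b) H` represents `R ∘ (a ·)`.

## References

* L. Hörmander, *The Analysis of Linear Partial Differential Operators I*, Thm 7.1.15
  (convolution theorem; folklore).
-/

noncomputable section

open MeasureTheory Set Filter Function SchwartzMap TopologicalSpace Distributions TestFunction Real
open scoped ENNReal NNReal Topology ComplexConjugate InnerProductSpace FourierTransform BigOperators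
  ContDiff

namespace Literature.Analysis.Hypoelliptic

variable {V : Type*} [NormedAddCommGroup V] [InnerProductSpace ℝ V] [FiniteDimensional ℝ V]
  [MeasurableSpace V] [BorelSpace V]

/-! ### The kernel `θ_b = conj ∘ 𝓕 b` -/

/-- The convolution kernel attached to a Schwartz function `b` on the Fourier space:
`θ_b = conj ∘ 𝓕 b`. [folklore] -/
def thetaOf (b : 𝓢(V, ℂ)) : V → ℂ := fun ζ => conj (𝓕 (b : V → ℂ) ζ)

/-- `θ_b` is rapidly decreasing. [folklore] -/
theorem rapidDecay_thetaOf (b : 𝓢(V, ℂ)) :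
    RapidDecay (thetaOf b) (fun N => 2 ^ N *
      (Finset.Iic (N, 0)).sup (fun m => SchwartzMap.seminorm ℂ m.1 m.2) (𝓕 b)) := by
  have h := SchwartzMap.rapidDecay (𝓕 b)
  refine ⟨?_, h.nonneg, fun N ζ => ?_⟩
  · exact Complex.continuous_conj.measurable.comp h.measurable
  · unfold thetaOf; rw [Complex.norm_conj, ← SchwartzMap.fourier_coe]; exact h.bound N ζ

/-- `conj (𝓕 f ζ) = 𝓕 (conj ∘ f) (-ζ)`. [folklore] -/
theorem conj_fourier_apply (f : V → ℂ) (ζ : V) : conj (𝓕 f ζ) = 𝓕 (fun v => conj (f v)) (-ζ) := by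
  rw [Real.fourier_eq', Real.fourier_eq', ← integral_conj]
  refine integral_congr_ae (Eventually.of_forall fun v => ?_)
  simp only [smul_eq_mul, map_mul, inner_neg_right]
  congr 1
  rw [← Complex.exp_conj, map_mul, Complex.conj_ofReal, Complex.conj_I]
  push_cast
  ring_nf

/-- For real `b`, `reflConj θ_b = θ_b`. [folklore] -/
theorem reflConj_thetaOf {b : 𝓢(V, ℂ)} (hb : ∀ v, conj (b v) = b v) : reflConj (thetaOf b) = thetaOf b := by
  ext ζ
  simp only [reflConj, thetaOf, Complex.conj_conj]
  rw [conj_fourier_apply]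
  have e : (fun v => conj ((b : V → ℂ) v)) = (b : V → ℂ) := funext fun v => hb v
  rw [e]

/-- `adjKer (convKer θ_b) ξ η = 𝓕 b (η - ξ)`. [folklore] -/
theorem adjKer_convKer_thetaOf (b : 𝓢(V, ℂ)) (ξ η : V) :
    adjKer (convKer (thetaOf b)) ξ η = 𝓕 (b : V → ℂ) (η - ξ) := by
  simp [adjKer, convKer, thetaOf]

/-! ### `kerOp (adjKer (convKer θ_b)) ψ = 𝓕⁻¹ (b · 𝓕 ψ)` -/

/-- The Fourier multiplier `ψ ↦ 𝓕⁻¹ (b · 𝓕 ψ)` on the Schwartz space. [folklore] -/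
def mulFourier (b : 𝓢(V, ℂ)) : 𝓢(V, ℂ) →L[ℂ] 𝓢(V, ℂ) :=
  (FourierTransform.fourierCLE ℂ (𝓢(V, ℂ))).symm.toContinuousLinearMap ∘L
    (SchwartzMap.smulLeftCLM ℂ (b : V → ℂ)) ∘L (FourierTransform.fourierCLE ℂ (𝓢(V, ℂ))).toContinuousLinearMap

/-- Pointwise: `mulFourier b ψ = 𝓕⁻ (fun y => b y * 𝓕 ψ y)`. [folklore] -/
theorem mulFourier_apply (b ψ : 𝓢(V, ℂ)) (ξ : V) :
    mulFourier b ψ ξ = 𝓕⁻ (fun y : V => b y * 𝓕 (ψ : V → ℂ) y) ξ := by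
  unfold mulFourier
  have hb : (b : V → ℂ).HasTemperateGrowth := b.hasTemperateGrowth
  simp only [ContinuousLinearMap.coe_comp, ContinuousLinearEquiv.coe_coe, Function.comp_apply,
    FourierTransform.fourierCLE_apply, FourierTransform.fourierCLE_symm_apply]
  rw [SchwartzMap.fourierInv_coe]
  have e : ((SchwartzMap.smulLeftCLM ℂ (b : V → ℂ)) (𝓕 ψ) : V → ℂ) = fun y => b y * 𝓕 (ψ : V → ℂ) y := by
    ext y; rw [SchwartzMap.smulLeftCLM_apply_apply hb, SchwartzMap.fourier_coe]; rfl
  rw [e]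

/-- **The convolution theorem we need**: `∫ 𝓕b(η - ξ) ψ(η) dη = 𝓕⁻¹ (b · 𝓕ψ)(ξ)` (Fubini).
[folklore] -/
theorem kerOp_adjKer_convKer_thetaOf (b ψ : 𝓢(V, ℂ)) (ξ : V) :
    kerOp (adjKer (convKer (thetaOf b))) ψ ξ = mulFourier b ψ ξ := by
  rw [mulFourier_apply, Real.fourierInv_eq']
  simp only [kerOp, adjKer_convKer_thetaOf]
  -- unfold `𝓕 ψ` inside and swap
  have hinner : ∀ y : V, 𝓕 (ψ : V → ℂ) y = ∫ v, Complex.exp ((↑(-2 * π * ⟪v, y⟫_ℝ) * Complex.I)) * ψ v :=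
    fun y => by rw [Real.fourier_eq']; rfl
  simp_rw [hinner, smul_eq_mul]
  -- the integrand of the double integral
  set F : V → V → ℂ := fun y v =>
    Complex.exp ((↑(2 * π * ⟪y, ξ⟫_ℝ) * Complex.I)) * b y * (Complex.exp ((↑(-2 * π * ⟪v, y⟫_ℝ) * Complex.I)) * ψ v) with hF
  have hFi : Integrable (uncurry F) (volume.prod volume) := by
    have hm : AEStronglyMeasurable (uncurry F) (volume.prod volume) := by
      apply Continuous.aestronglyMeasurable
      simp only [hF]
      fun_prop
    have hbound : ∀ p : V × V, ‖uncurry F p‖ = ‖b p.1‖ * ‖ψ p.2‖ := fun p => by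
      simp only [hF, uncurry, norm_mul, Complex.norm_exp_ofReal_mul_I, one_mul]
    have hg : Integrable (fun p : V × V => ‖b p.1‖ * ‖ψ p.2‖) (volume.prod volume) :=
      (b.integrable.norm).mul_prod (ψ.integrable.norm)
    exact hg.mono' hm (Eventually.of_forall fun p => (hbound p).le)
  have hswap := MeasureTheory.integral_integral_swap hFi
  -- left side of `hswap` is `∫ y, ∫ v, F y v`; rewrite our goal's RHS into that form
  have eR : ∫ y, Complex.exp ((↑(2 * π * ⟪y, ξ⟫_ℝ) * Complex.I)) *
      (b y * ∫ v, Complex.exp ((↑(-2 * π * ⟪v, y⟫_ℝ) * Complex.I)) * ψ v) = ∫ y, ∫ v, F y v := by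
    refine integral_congr_ae (Eventually.of_forall fun y => ?_)
    simp only [hF]
    rw [← mul_assoc, ← integral_const_mul]
  rw [eR, hswap]
  refine integral_congr_ae (Eventually.of_forall fun v => ?_)
  -- `∫ y, F y v = 𝓕 b (v - ξ) * ψ v`
  show 𝓕 (b : V → ℂ) (v - ξ) * ψ v = ∫ y, F y v
  rw [Real.fourier_eq', ← integral_mul_const]
  refine integral_congr_ae (Eventually.of_forall fun y => ?_)
  simp only [hF, smul_eq_mul, inner_sub_right]
  have e : Complex.exp ((↑(2 * π * ⟪y, ξ⟫_ℝ) * Complex.I)) * Complex.exp ((↑(-2 * π * ⟪v, y⟫_ℝ) * Complex.I)) =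
      Complex.exp ((↑(-2 * π * (⟪y, v⟫_ℝ - ⟪y, ξ⟫_ℝ)) * Complex.I)) := by
    rw [← Complex.exp_add, real_inner_comm v y]
    congr 1; push_cast; ring
  rw [← e]
  ring

/-! ### The shadow of a convolution coefficient -/

variable {E : Type*} [NormedAddCommGroup E] [NormedSpace ℝ E] {Ω : Opens E}
variable {u : 𝓓'(Ω, ℝ)} {ζ : 𝓓(Ω, ℝ)}

/-- Multiplication by a real function as an operator on complex functions. [folklore] -/
def mulC (a : E → ℝ) (h : E → ℂ) : E → ℂ := fun x => (a x : ℂ) * h x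

/-- `mulC` preserves smoothness for smooth `a`. [folklore] -/
theorem contDiff_mulC {a : E → ℝ} (ha : ContDiff ℝ ∞ a) {h : E → ℂ} (hh : ContDiff ℝ ∞ h) :
    ContDiff ℝ ∞ (mulC a h) :=
  (Complex.ofRealCLM.contDiff.comp ha).mul hh

/-- **Shadow of a convolution**: let `a : E → ℝ` be smooth with `a ∘ T⁻¹ = b` a real Schwartz
function on `V`. If `H` represents `R` then `kerOp (convKer θ_b) H` represents `R ∘ (a ·)`.
[folklore] -/
theorem Rep.conv {T : E ≃L[ℝ] V} {H : V → ℂ} {R : (E → ℂ) → (E → ℂ)}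
    (hR : Rep u ζ (T : E →L[ℝ] V) H R) {a : E → ℝ} (ha : ContDiff ℝ ∞ a) {b : 𝓢(V, ℂ)}
    (hab : ∀ x, (a x : ℂ) = b (T x)) :
    Rep u ζ (T : E →L[ℝ] V) (kerOp (convKer (thetaOf b)) H) (fun h => R (mulC a h)) := by
  obtain ⟨t, ht⟩ := hR.inH
  have hK := (rapidDecay_thetaOf b).kerDecay_convKer
  refine ⟨⟨t, by have := hK.inH_kerOp ht; rwa [sub_zero] at this⟩,
    fun h hh => hR.smooth _ (contDiff_mulC ha hh), fun h g hh hg => ?_, fun c h hh => ?_, fun ψ => ?_⟩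
  · have e : mulC a (fun x => h x + g x) = fun x => mulC a h x + mulC a g x := by
      ext x; simp only [mulC]; ring
    rw [e, hR.add _ _ (contDiff_mulC ha hh) (contDiff_mulC ha hg)]
  · have e : mulC a (fun x => c * h x) = fun x => c * mulC a h x := by
      ext x; simp only [mulC]; ring
    rw [e, hR.hom c _ (contDiff_mulC ha hh)]
  · -- move the kernel across and identify the Fourier multiplier
    have hψ := SchwartzMap.nice ψ
    rw [hK.pairing_kerOp_left ht (hψ.inH _)]
    have e1 : kerOp (adjKer (convKer (thetaOf b))) ψ = ((mulFourier b ψ : 𝓢(V, ℂ)) : V → ℂ) := by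
      ext ξ; exact kerOp_adjKer_convKer_thetaOf b ψ ξ
    rw [e1, hR.eq (mulFourier b ψ)]
    congr 1
    -- `conj (𝓕 (mulFourier b ψ) (T x)) = a x * conj (𝓕 ψ (T x))`
    have e2 : 𝓕 (mulFourier b ψ) = SchwartzMap.smulLeftCLM ℂ (b : V → ℂ) (𝓕 ψ) := by
      unfold mulFourier
      simp only [ContinuousLinearMap.coe_comp, ContinuousLinearEquiv.coe_coe, Function.comp_apply,
        FourierTransform.fourierCLE_apply]
      exact (FourierTransform.fourierCLE ℂ (𝓢(V, ℂ))).apply_symm_apply _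
    have hb : (b : V → ℂ).HasTemperateGrowth := b.hasTemperateGrowth
    congr 1
    ext x
    simp only [mulC]
    simp only [ContinuousLinearEquiv.coe_coe]
    rw [e2, SchwartzMap.smulLeftCLM_apply_apply hb, smul_eq_mul, map_mul, ← hab x, Complex.conj_ofReal]

end Literature.Analysis.Hypoelliptic
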